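import Literature.Geometry.Kaehler.SiegelTorusThetaDivisorSingular
import Literature.Analysis.SpecialFunctions.RiemannThetaBlockDiagonalHessian
import HarnessLib

/-!
# The tangent cone of `Θ` at a singular point: the Hessian rank is well defined on `Sing Θ ⊂ X_Ω`;
# a decomposable p.p.a.v. lies in `θ_null²`

Layer `Literature/Geometry/Kaehler`, namespace `Literature.Geometry.Kaehler.ComplexTorus` (lane
`lit-hodgefound`, Layer A4, theta-divisor row A4-17; prover seat `lit-hodgefound-p23`, row «A4-17(k)»).
Sequel of `SiegelTorusThetaDivisorSingular.lean` (`Sing Θ = π({ϑ = dϑ = 0})`, the first-order transport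
`riemannTheta_singular_iff_of_add_latticeVec` along the automorphy factor `e = siegelFactor Ω m`) and of
`Literature/Analysis/SpecialFunctions/RiemannThetaBlockDiagonalHessian.lean` (for `Ω = Ω₁ ⊕ Ω₂` the
Hessian of `ϑ_Ω` at a point of `{ϑ₁ = 0} × {ϑ₂ = 0}` has rank `≤ 2`).

Sources followed (held texts, read at the quoted chunks).

* S. Grushevsky, R. Salvati Manni, *Jacobians with a vanishing theta-null in genus 4*, Israel J. Math.
  164 (2008) [held `paper:arxiv-math_0605160`]: p0005 "if a point … of order two is a singular point in the
  theta divisor … the rank of the quadric defining the tangent cone at `x` is the rank of the matrix" of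
  second derivatives of `θ`; p0004/p0007: the loci `θ_null^k` "where the rank of the tangent cone" is at most
  `k`; p0007 "ppavs with reducible theta divisor are in `θ_null²` — in this case the tangent cone is a quadric
  that is the union of two hyperplanes".
* S. Grushevsky, *The Schottky problem* (MSRI Publ. 59, 2012), §5 [held `paper:arxiv-1009.0369` p0011]:
  `Sing Θ ⊃ Θ₁ × Θ₂` for a decomposable p.p.a.v.; `θ_null^3 ⊂ θ_null^{g−1}`, "rank of the tangent cone".
* H. Lange, *Abelian Varieties over the Complex Numbers* (2023), §2.1.2 [held p0079–p0080]: `π^*D = (ϑ)`,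
  the local equation `ϑ` of `Θ` changes by the nowhere-vanishing factor of automorphy under `Λ`.

What is here (theorems only; no definition, no named fact, net debt `0`). The Hessian of `ϑ(·, Ω)` at `v`
is written `D²ϑ(v)[u, u'] = fderiv (fun z ↦ fderiv ϑ z u) v u'`, its matrix `(∂ᵢ∂ⱼϑ(v))` on the standard
basis `Pi.single i 1`.

* **`fderiv_fderiv_riemannTheta_add_latticeVec_of_singular`** — at a point `w` of `{ϑ = dϑ = 0}` and for a
  lattice vector `λ = latticeVec Φ m`: `D²ϑ(w + λ)[u, u'] = e(w) · D²ϑ(w)[u, u']` with the automorphy factor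
  `e = siegelFactor Ω m`, `e(w) ≠ 0` (differentiate `ϑ(z + λ) = e(z) ϑ(z)` twice; the cross terms carry
  `ϑ(w) = 0` or `dϑ(w) = 0`); `hessian_riemannTheta_add_latticeVec_of_singular` (matrix form
  `(∂ᵢ∂ⱼϑ(w + λ)) = e(w) • (∂ᵢ∂ⱼϑ(w))`).
* **`rank_hessian_riemannTheta_eq_of_cover_eq`** — the RANK OF THE TANGENT CONE IS WELL DEFINED ON `Sing Θ`:
  for two lifts `v, v'` of the same point `x = π(v) = π(v') ∈ Sing Θ`, `rank (∂ᵢ∂ⱼϑ(v)) = rank (∂ᵢ∂ⱼϑ(v'))`.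
* **`rank_hessian_le_two_of_mem_inter_preimage_thetaDivisor`** — a DECOMPOSABLE p.p.a.v. `X = X_{Ω₁ ⊕ Ω₂}`
  lies in `θ_null²` in the sense of the defining function: at every point of `p₁⁻¹Θ₁ ∩ p₂⁻¹Θ₂`
  (`= Θ₁ × Θ₂ ⊆ Sing Θ`, `inter_preimage_thetaDivisor_subset_thetaDivisorSing`) and for EVERY lift `v`, the
  Hessian `(∂ᵢ∂ⱼϑ_Ω(v))` has rank `≤ 2`.

Not here: `θ_null^k ⊂ 𝒜_g` as loci / modular forms, the heat-equation rewriting of the Hessian, the converse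
inclusion, multiplicities `≥ 3`.

## References

* [GrushevskySalvatiManni2008] S. Grushevsky, R. Salvati Manni, Jacobians with a vanishing theta-null in
  genus 4, Israel J. Math. 164 (2008), 303–315 (arXiv:math/0605160), pp. 4–5, 7 of the held text.
* [Grushevsky2012SchottkyProblem] S. Grushevsky, The Schottky problem, MSRI Publ. 59 (2012), §5.
* [Lange2023AbelianVarietiesComplex] H. Lange, Abelian Varieties over the Complex Numbers (2023), §2.1.2.
-/

noncomputable section

open scoped Manifold Topology
open Set Function Complex Matrix Filter
open Literature.Analysis.SpecialFunctions Literature.Analysis.Complex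

namespace Literature.Geometry.Kaehler

namespace ComplexTorus

/-! ### The Hessian at a point of `{ϑ = dϑ = 0}` transforms by the automorphy factor -/

section Descent

variable {n : ℕ} (Ω : Matrix (Fin n) (Fin n) ℂ) (hΩ : ∀ i j, Ω i j = Ω j i)
  (hpos : (Matrix.of fun i j => (Ω i j).im).PosDef)
  (Φ : (Fin n ⊕ Fin n → ℝ) ≃L[ℝ] (Fin n → ℂ))
  (hΦ : ∀ v i, Φ v i = (v (Sum.inl i) : ℂ) + ∑ j, Ω i j * (v (Sum.inr j) : ℂ))

/-- `rank (c • A) = rank A` for `c ≠ 0`. [folklore] -/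
private theorem rank_smul_of_ne_zero {m : Type*} [Fintype m] [DecidableEq m] {c : ℂ} (hc : c ≠ 0)
    (A : Matrix m m ℂ) : (c • A).rank = A.rank := by
  refine le_antisymm ?_ ?_
  · rw [Matrix.smul_eq_diagonal_mul]
    exact Matrix.rank_mul_le_right _ _
  · conv_lhs => rw [show A = c⁻¹ • (c • A) by rw [smul_smul, inv_mul_cancel₀ hc, one_smul]]
    rw [Matrix.smul_eq_diagonal_mul]
    exact Matrix.rank_mul_le_right _ _

include hΩ hpos hΦ in
/-- **Second-order transport along the lattice**: at a point `w` with `ϑ(w) = 0` and `dϑ(w) = 0`, for every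
lattice vector `λ = latticeVec Φ m` and all tangent vectors `u, u'`,
`D²ϑ(w + λ)[u, u'] = e(w) · D²ϑ(w)[u, u']`, `e = siegelFactor Ω m` the (nowhere-vanishing) factor of
automorphy of `ϑ(z + λ) = e(z) ϑ(z)` — the terms `dϑ(w)[u] de(w)[u']`, `de(w)[u] dϑ(w)[u']`, `ϑ(w) D²e(w)[u,u']`
of the twice-differentiated functional equation vanish at a point of `{ϑ = dϑ = 0}`.
[cite: Lange2023AbelianVarietiesComplex, §2.1.2 (p0079–p0080)] [cite: GrushevskySalvatiManni2008, p0005 of the held text] -/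
theorem fderiv_fderiv_riemannTheta_add_latticeVec_of_singular {v w : Fin n → ℂ} {m : Fin n ⊕ Fin n → ℤ}
    (hv : w + latticeVec Φ m = v) (h0 : riemannTheta Ω w = 0) (hd : fderiv ℂ (riemannTheta Ω) w = 0)
    (u u' : Fin n → ℂ) :
    fderiv ℂ (fun z ↦ fderiv ℂ (riemannTheta Ω) z u) v u' =
      siegelFactor Ω m w * fderiv ℂ (fun z ↦ fderiv ℂ (riemannTheta Ω) z u) w u' := by
  obtain ⟨c, hc, hY⟩ := exists_pos_mul_sum_sq_le_of_posDef_im Ω hpos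
  have hmem := riemannTheta_mem_thetaFunctions Ω hΩ hpos Φ hΦ
  have hdθ : Differentiable ℂ (riemannTheta Ω) := hmem.1
  have hde : Differentiable ℂ (siegelFactor Ω m) := differentiable_siegelFactor Ω m
  -- the functional equation as an identity of functions of `z`, and its first derivative at every `z`
  have hfun : (fun z : Fin n → ℂ ↦ riemannTheta Ω (z + latticeVec Φ m)) =
      siegelFactor Ω m * riemannTheta Ω :=
    funext fun z ↦ hmem.2 m z
  have H1 : ∀ z, fderiv ℂ (riemannTheta Ω) (z + latticeVec Φ m) u =
      siegelFactor Ω m z * fderiv ℂ (riemannTheta Ω) z u +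
        riemannTheta Ω z * fderiv ℂ (siegelFactor Ω m) z u := by
    intro z
    rw [← fderiv_comp_add_right (latticeVec Φ m), hfun, fderiv_mul (hde z) (hdθ z)]
    simp only [_root_.add_apply, _root_.smul_apply, smul_eq_mul]
  -- differentiability of `z ↦ dϑ(z)[u]` and `z ↦ de(z)[u]` (both entire)
  have hG : Differentiable ℂ fun z ↦ fderiv ℂ (riemannTheta Ω) z u :=
    differentiable_fderiv_riemannTheta_apply Ω hc hY u
  have hE : Differentiable ℂ fun z ↦ fderiv ℂ (siegelFactor Ω m) z u := by
    have han := (ThetaRigidity.analyticOnNhd_univ hde).fderiv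
    have hdd : Differentiable ℂ (fderiv ℂ (siegelFactor Ω m)) := fun x ↦
      (han x (Set.mem_univ x)).differentiableAt
    exact (ContinuousLinearMap.apply ℂ ℂ u).differentiable.comp hdd
  have hsum := (((hde w).hasFDerivAt.mul (hG w).hasFDerivAt)).add
    ((hdθ w).hasFDerivAt.mul (hE w).hasFDerivAt)
  have key := hsum.congr_of_eventuallyEq (Filter.Eventually.of_forall fun z ↦ (by
    show fderiv ℂ (riemannTheta Ω) (z + latticeVec Φ m) u = _
    simp only [Pi.add_apply, Pi.mul_apply]
    exact H1 z))
  rw [← hv, ← fderiv_comp_add_right (latticeVec Φ m), key.fderiv]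
  simp only [_root_.add_apply, _root_.smul_apply, smul_eq_mul, h0, hd, _root_.zero_apply, zero_mul,
    mul_zero, add_zero]

include hΩ hpos hΦ in
/-- Matrix form of the second-order transport: `(∂ᵢ∂ⱼϑ(w + λ)) = e(w) • (∂ᵢ∂ⱼϑ(w))` at a point `w` of
`{ϑ = dϑ = 0}`. [cite: GrushevskySalvatiManni2008, p0005 of the held text] [cite: Lange2023AbelianVarietiesComplex, §2.1.2 (p0079–p0080)] -/
theorem hessian_riemannTheta_add_latticeVec_of_singular {v w : Fin n → ℂ} {m : Fin n ⊕ Fin n → ℤ}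
    (hv : w + latticeVec Φ m = v) (h0 : riemannTheta Ω w = 0) (hd : fderiv ℂ (riemannTheta Ω) w = 0) :
    (Matrix.of fun i j : Fin n ↦ fderiv ℂ (fun z ↦ fderiv ℂ (riemannTheta Ω) z (Pi.single i (1 : ℂ))) v
        (Pi.single j (1 : ℂ))) =
      siegelFactor Ω m w •
        Matrix.of fun i j : Fin n ↦ fderiv ℂ (fun z ↦ fderiv ℂ (riemannTheta Ω) z (Pi.single i (1 : ℂ))) w
          (Pi.single j (1 : ℂ)) := by
  ext i j
  rw [Matrix.of_apply, Matrix.smul_apply, Matrix.of_apply, smul_eq_mul,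
    fderiv_fderiv_riemannTheta_add_latticeVec_of_singular Ω hΩ hpos Φ hΦ hv h0 hd]

include hΩ hpos hΦ in
/-- **The rank of the tangent cone is well defined on `Sing Θ ⊂ X_Ω`**: for a point `x = π(v) ∈ Sing Θ`
and any other lift `v'` of `x` (`π(v') = π(v)`), the Hessian matrices `(∂ᵢ∂ⱼϑ(v))`, `(∂ᵢ∂ⱼϑ(v'))` differ by
the non-zero scalar `e(v)` and have the same rank — so "the rank of the quadric defining the tangent cone"
at a singular point of `Θ`, and the loci `θ_null^k`, make sense on the torus.
[cite: GrushevskySalvatiManni2008, p0004–p0005 of the held text] [cite: Grushevsky2012SchottkyProblem, §5 (held p0011)] -/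
theorem rank_hessian_riemannTheta_eq_of_cover_eq {v v' : Fin n → ℂ}
    (hx : cover Φ v ∈ thetaDivisorSing Ω hΩ hpos Φ hΦ) (hvv' : cover Φ v' = cover Φ v) :
    (Matrix.of fun i j : Fin n ↦ fderiv ℂ (fun z ↦ fderiv ℂ (riemannTheta Ω) z (Pi.single i (1 : ℂ))) v'
        (Pi.single j (1 : ℂ))).rank =
      (Matrix.of fun i j : Fin n ↦ fderiv ℂ (fun z ↦ fderiv ℂ (riemannTheta Ω) z (Pi.single i (1 : ℂ))) v
        (Pi.single j (1 : ℂ))).rank := by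
  obtain ⟨m, hm⟩ := (cover_eq_cover_iff Φ v' v).1 hvv'
  obtain ⟨h0, hd⟩ := (cover_mem_thetaDivisorSing_iff Ω hΩ hpos Φ hΦ v).1 hx
  rw [hessian_riemannTheta_add_latticeVec_of_singular Ω hΩ hpos Φ hΦ hm.symm h0 hd,
    rank_smul_of_ne_zero ((isFactor_siegelFactor Ω hΩ Φ hΦ).ne_zero m v)]

end Descent

/-! ### A decomposable p.p.a.v. lies in `θ_null²` -/

section Product

variable {n₁ n₂ : ℕ} (Ω₁ : Matrix (Fin n₁) (Fin n₁) ℂ) (Ω₂ : Matrix (Fin n₂) (Fin n₂) ℂ)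
  {Ω : Matrix (Fin (n₁ + n₂)) (Fin (n₁ + n₂)) ℂ}
  (hΩb : Ω = Matrix.reindex finSumFinEquiv finSumFinEquiv (Matrix.fromBlocks Ω₁ 0 0 Ω₂))
  (hΩ : ∀ i j, Ω i j = Ω j i) (hpos : (Matrix.of fun i j => (Ω i j).im).PosDef)
  (Φ : (Fin (n₁ + n₂) ⊕ Fin (n₁ + n₂) → ℝ) ≃L[ℝ] (Fin (n₁ + n₂) → ℂ))
  (hΦ : ∀ v i, Φ v i = (v (Sum.inl i) : ℂ) + ∑ j, Ω i j * (v (Sum.inr j) : ℂ))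
  (hΩ₁ : ∀ i j, Ω₁ i j = Ω₁ j i) (hpos₁ : (Matrix.of fun i j => (Ω₁ i j).im).PosDef)
  (Φ₁ : (Fin n₁ ⊕ Fin n₁ → ℝ) ≃L[ℝ] (Fin n₁ → ℂ))
  (hΦ₁ : ∀ v i, Φ₁ v i = (v (Sum.inl i) : ℂ) + ∑ j, Ω₁ i j * (v (Sum.inr j) : ℂ))
  (hΩ₂ : ∀ i j, Ω₂ i j = Ω₂ j i) (hpos₂ : (Matrix.of fun i j => (Ω₂ i j).im).PosDef)
  (Φ₂ : (Fin n₂ ⊕ Fin n₂ → ℝ) ≃L[ℝ] (Fin n₂ → ℂ))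
  (hΦ₂ : ∀ v i, Φ₂ v i = (v (Sum.inl i) : ℂ) + ∑ j, Ω₂ i j * (v (Sum.inr j) : ℂ))

include hΩb hpos₁ hpos₂ hΦ hΦ₁ hΦ₂ in
/-- **"ppavs with reducible theta divisor are in `θ_null²`"** for `X = X_{Ω₁ ⊕ Ω₂}`: at every point
`x = π(v)` of `p₁⁻¹Θ₁ ∩ p₂⁻¹Θ₂` (`= Θ₁ × Θ₂ ⊆ Sing Θ`), and for every lift `v` of `x`, the Hessian matrix
`(∂ᵢ∂ⱼϑ_Ω(v))` — "the rank of the quadric defining the tangent cone" — has rank at most `2`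
(`rank_hessian_riemannTheta_blockDiag_le_two`: it is `β ⊗ α + α ⊗ β` for the two gradients).
[cite: GrushevskySalvatiManni2008, p0007 of the held text] [cite: Grushevsky2012SchottkyProblem, §5 (held p0011)] -/
theorem rank_hessian_le_two_of_mem_inter_preimage_thetaDivisor (v : Fin (n₁ + n₂) → ℂ)
    (h₁ : mapMatrix Φ Φ₁ ((1 : Matrix _ _ ℤ).submatrix (Sum.map (Fin.castAdd n₂) (Fin.castAdd n₂)) id)
      (cover Φ v) ∈ thetaDivisor Ω₁ hΩ₁ hpos₁ Φ₁ hΦ₁)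
    (h₂ : mapMatrix Φ Φ₂ ((1 : Matrix _ _ ℤ).submatrix (Sum.map (Fin.natAdd n₁) (Fin.natAdd n₁)) id)
      (cover Φ v) ∈ thetaDivisor Ω₂ hΩ₂ hpos₂ Φ₂ hΦ₂) :
    (Matrix.of fun i j : Fin (n₁ + n₂) ↦ fderiv ℂ (fun z ↦ fderiv ℂ (riemannTheta Ω) z
        (Pi.single i (1 : ℂ))) v (Pi.single j (1 : ℂ))).rank ≤ 2 := by
  obtain ⟨c₁, hc₁, hY₁⟩ := exists_pos_mul_sum_sq_le_of_posDef_im Ω₁ hpos₁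
  obtain ⟨c₂, hc₂, hY₂⟩ := exists_pos_mul_sum_sq_le_of_posDef_im Ω₂ hpos₂
  rw [mapMatrix_submatrix_one, cover_restrict_fst Ω₁ Ω₂ hΩb Φ hΦ Φ₁ hΦ₁, cover_mem_thetaDivisor_iff] at h₁
  rw [mapMatrix_submatrix_one, cover_restrict_snd Ω₁ Ω₂ hΩb Φ hΦ Φ₂ hΦ₂, cover_mem_thetaDivisor_iff] at h₂
  exact rank_hessian_riemannTheta_blockDiag_le_two hΩb hc₁ hc₂ hY₁ hY₂ v h₁ h₂

include hΩb hpos₁ hpos₂ hΦ hΦ₁ hΦ₂ in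
/-- The same at the points of `Sing Θ` supplied by `Θ₁ × Θ₂`: such a point lies on `Sing Θ`
(`inter_preimage_thetaDivisor_subset_thetaDivisorSing`) AND its tangent cone has rank `≤ 2`.
[cite: GrushevskySalvatiManni2008, p0007 of the held text] [cite: Grushevsky2012SchottkyProblem, §5 (held p0011)] -/
theorem mem_thetaDivisorSing_and_rank_hessian_le_two (v : Fin (n₁ + n₂) → ℂ)
    (h₁ : mapMatrix Φ Φ₁ ((1 : Matrix _ _ ℤ).submatrix (Sum.map (Fin.castAdd n₂) (Fin.castAdd n₂)) id)
      (cover Φ v) ∈ thetaDivisor Ω₁ hΩ₁ hpos₁ Φ₁ hΦ₁)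
    (h₂ : mapMatrix Φ Φ₂ ((1 : Matrix _ _ ℤ).submatrix (Sum.map (Fin.natAdd n₁) (Fin.natAdd n₁)) id)
      (cover Φ v) ∈ thetaDivisor Ω₂ hΩ₂ hpos₂ Φ₂ hΦ₂) :
    cover Φ v ∈ thetaDivisorSing Ω hΩ hpos Φ hΦ ∧
      (Matrix.of fun i j : Fin (n₁ + n₂) ↦ fderiv ℂ (fun z ↦ fderiv ℂ (riemannTheta Ω) z
        (Pi.single i (1 : ℂ))) v (Pi.single j (1 : ℂ))).rank ≤ 2 :=
  ⟨inter_preimage_thetaDivisor_subset_thetaDivisorSing Ω₁ Ω₂ hΩb hΩ hpos Φ hΦ hΩ₁ hpos₁ Φ₁ hΦ₁ hΩ₂ hpos₂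
      Φ₂ hΦ₂ ⟨h₁, h₂⟩,
    rank_hessian_le_two_of_mem_inter_preimage_thetaDivisor Ω₁ Ω₂ hΩb Φ hΦ hΩ₁ hpos₁ Φ₁ hΦ₁ hΩ₂ hpos₂ Φ₂
      hΦ₂ v h₁ h₂⟩

end Product

end ComplexTorus

end Literature.Geometry.Kaehler

end
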